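import Summits.MatrixMultiplication.OmegaCensus.STPPVosperSlackFourRows61F5A01

/-!
# ω-census (abelian STPP census): fifth leaf ℤ₆₁ {(2,2,2),(3,3,3)²} (slack 4) — cells δ₁ = 0 / δ₂′ = 0: `caseADeadT` rows up to dihedral symmetry — rows assembled (kernel rows → law form)

HONEST FRAMING (pub-omega census; verbatim): lottery ticket; floor = certified bounds/negative ranges.
Census STRUCTURE (seat pub-omega-stpp-2 gen 27, 2026-08-29), family (b2).  The 4 chunk theorems `rows61F5A0_c0 … rows61F5A0_c3` glued into the
hypothesis form the law consumes (`rows61F5A0`).  No new computation.  Nothing here is progress on `ω`.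
-/

namespace Summit.MatrixMultiplication.OmegaCensus.CubeNB.S2

/-- **Assembled rows** (`fifth leaf ℤ₆₁ {(2,2,2),(3,3,3)²} (slack 4) — cells δ₁ = 0 / δ₂′ = 0: `caseADeadT` rows up to dihedral symmetry`). [folklore] -/
theorem rows61F5A0 : ∀ Q ∈ qShapes 61 3 0 1770, dihedralSmaller 61 Q = true ∨ caseADeadT 61 3 3 13 13 Q tblZ61F5A0 = true := by
  have g0 : ∀ Q ∈ qShapes 61 3 0 1213, dihedralSmaller 61 Q = true ∨ caseADeadT 61 3 3 13 13 Q tblZ61F5A0 = true := (rowsQ_of_all rows61F5A0_c0)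
  have g1 : ∀ Q ∈ qShapes 61 3 0 1460, dihedralSmaller 61 Q = true ∨ caseADeadT 61 3 3 13 13 Q tblZ61F5A0 = true :=
    forall_qShapes_append (by decide) (by decide) g0 (rowsQ_of_all rows61F5A0_c1)
  have g2 : ∀ Q ∈ qShapes 61 3 0 1633, dihedralSmaller 61 Q = true ∨ caseADeadT 61 3 3 13 13 Q tblZ61F5A0 = true :=
    forall_qShapes_append (by decide) (by decide) g1 (rowsQ_of_all rows61F5A0_c2)
  have g3 : ∀ Q ∈ qShapes 61 3 0 1770, dihedralSmaller 61 Q = true ∨ caseADeadT 61 3 3 13 13 Q tblZ61F5A0 = true :=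
    forall_qShapes_append (by decide) (by decide) g2 (rowsQ_of_all rows61F5A0_c3)
  exact g3

/-- The same with the bound written `(61 − 1).choose (3 − 1)`. [folklore] -/
theorem rows61F5A0_choose : ∀ Q ∈ qShapes 61 3 0 ((61 - 1).choose (3 - 1)), dihedralSmaller 61 Q = true ∨ caseADeadT 61 3 3 13 13 Q tblZ61F5A0 = true := by
  have e : (61 - 1).choose (3 - 1) = 1770 := by decide
  rw [e]
  exact rows61F5A0

end Summit.MatrixMultiplication.OmegaCensus.CubeNB.S2
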